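import Mathlib
import Summits.Schanuel.Schanuel.Theses.RigidCore
import Summits.Schanuel.Schanuel.Theses.GaussianStokesSector
import Literature.FieldTheory.TranscendenceDegree.AlgebraicDependenceBookkeeping

/-!
# Line `sector-split` (route `RigidCore`): the `GL_n(ℚ)` sector glue along `V₂ = ℚ̄ ⊕ ℚπi`

Prover file for the registered stubs `stub_sectorGlue` and `stub_sectorAssembly` of line
`sector-split` of crux `stmt-Schanuel-0970`
(`Summit.Schanuel.Schanuel.Theses.RigidCore.SchanuelOnLogFreeCore`, "(R)": Schanuel's statement
for `ℚ`-linearly independent tuples from the log-free core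
`C_EA = sInf {K ≤ ℂ | 2πi ∈ K, K exp-closed, K relatively algebraically closed}`).

The line splits (R) along the `ℚ`-subspace `E = V₂ = span_ℚ(ℚ̄ ∪ {πi})` over the π–LW field
`L = K₂ = ℚ(ℚ̄ ∪ {πi} ∪ e^{ℚ̄})`:
* residue 1 = `GaussianStokesSector.PiFreeOverLWField` (item stmt-Schanuel-9545, the INSIDE
  count: `d + 1 ≤ trdeg ℚ(π, e^a)` for `ℚ`-free algebraic `a`);
* residue 2 = `GaussianStokesSector.RelSchanuelOverPiLWField` restricted to CORE tuples (the
  OUTSIDE count: `n ≤ trdeg_L L(x, eˣ)` for core `x` free modulo `E`).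

Both stubs are ONE engine `SectorGlue.engine`, run over an arbitrary constraint `ℚ`-submodule
`C ≤ ℂ` (the tuple lies in `C`, and the outside count is only assumed for tuples from `C`):
`C = C_EA` (as a `ℚ`-submodule) gives `stub_sectorGlue`, `C = ⊤` gives `stub_sectorAssembly`
(= the statement of the assembly item stmt-Schanuel-9557 shared by routes ExceptionalSubspaces /
GaussianStokesSector / SingularModulusScaling, whose only previous tree proof is INLINED in
`Theses/SingularModulusScaling.lean` `closes`; the engine below is that proof, adapted).

Proof of the engine (Kirby's `GL_n(ℚ)` base change; J. Kirby, *Exponential algebraicity in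
exponential fields*, Bull. LMS 42 (2010), §3; M. Waldschmidt, *Diophantine approximation on linear
algebraic groups* (2000), §1.4).  Let `x` be `ℚ`-free in `C`, `V = span_ℚ(x)`, `W = V ⊓ E`,
`U` a complement of `W` in `V`, `y` a basis of `W` (`k` vectors, all in `E`) and `z` a basis of
`U` (`m` vectors, free modulo `E`, all in `V ≤ C`), `k + m = n`.
1. INSIDE (`SectorGlue.inside_count`): `k ≤ trdeg ℚ(y, eʸ)`.  Write `yᵢ = bᵢ + qᵢ·πi`
   (`bᵢ ∈ ℚ̄`, `qᵢ ∈ ℚ`).  If all `qᵢ = 0`, `y` is algebraic and `PiFreeOverLWField` at `y` gives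
   `k + 1 ≤ trdeg ℚ(π, eʸ) ≤ trdeg ℚ(y, eʸ) + 1`.  Otherwise pick `q_j ≠ 0` and put
   `a_s = q_j y_s − q_s y_j` (`s ≠ j`): `k − 1` algebraic `ℚ`-free numbers, so
   `k ≤ trdeg ℚ(π, eᵃ)`, and `π, e^{a_s}` are algebraic over `ℚ(y, eʸ)`
   (`πi = (y_j − b_j)/q_j`, `e^{a_s} = (e^{y_s})^{q_j} (e^{y_j})^{-q_s}` up to roots).
2. OUTSIDE: the hypothesis at `z` gives `m ≤ trdeg_L L(z, eᶻ) ≤ trdeg_{Ky} Ky(z, eᶻ)` for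
   `Ky = ℚ(y, eʸ) ≤ L` (base change DOWN a finite generating set only increases the transcendence
   degree: `SectorGlue.trdeg_adjoin_antitone_base`).
3. TOWER: `trdeg ℚ(y,eʸ) + trdeg_{Ky} Ky(z,eᶻ) ≤ trdeg ℚ(y,eʸ,z,eᶻ) ≤ trdeg ℚ(x,eˣ)`, the last
   step because `y, z ∈ V = span_ℚ(x)` makes `y, z, eʸ, eᶻ` algebraic over `ℚ(x, eˣ)`.

Everything used is Mathlib / the fact-free bookkeeping file
`Literature.FieldTheory.TranscendenceDegree.AlgebraicDependenceBookkeeping`; the two Schanuel-type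
statements are HYPOTHESES.  No new definitions.
-/

namespace Summit.Schanuel.Schanuel.Theorems.RigidCore

open Summit.Schanuel.Schanuel.Theses

namespace SectorGlue

open IntermediateField Complex Submodule Set Function Literature.FieldTheory.TranscendenceDegree
open Algebra (trdeg)

/-- Every algebra over a field into a nontrivial ring is faithful (the algebra map of a field is
injective). [folklore] -/
theorem faithfulSMul_of_field (A B : Type) [Field A] [Ring B] [Nontrivial B] [Algebra A B] :
    FaithfulSMul A B :=
  (faithfulSMul_iff_algebraMap_injective A B).2 (algebraMap A B).injective

/-- Monotonicity of the transcendence degree along an inclusion of intermediate fields.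
[folklore] -/
theorem trdeg_mono {K : Type} [Field K] [Algebra K ℂ] {A B : IntermediateField K ℂ} (h : A ≤ B) :
    trdeg K A ≤ trdeg K B :=
  trdeg_le_of_injective (IntermediateField.inclusion h)
    (IntermediateField.inclusion_injective h)

/-- Rational multiples in the exponent stay algebraic: if `e^u` is algebraic over `R` then so is
`e^{q u}` for every `q ∈ ℚ` (raise to the power `den q`). [folklore] -/
theorem exp_rat_mul_mem_algebraicClosure (R : Type) [Field R] [Algebra R ℂ] (u : ℂ) (q : ℚ)
    (hu : exp u ∈ algebraicClosure R ℂ) : exp (q * u) ∈ algebraicClosure R ℂ := by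
  rw [mem_algebraicClosure_iff]
  refine .of_pow q.den_pos ?_
  rw [← exp_nat_mul, ← mul_assoc, ← Rat.cast_natCast, ← Rat.cast_mul, Rat.den_mul_eq_num,
    Rat.cast_intCast, exp_int_mul]
  exact mem_algebraicClosure_iff.1 (zpow_mem hu _)

/-- If `T` is algebraic over an intermediate field `M`, then `trdeg_K K(T) ≤ trdeg_K M`.
[folklore] -/
theorem trdeg_adjoin_le_of_subset_algebraicClosure (K : Type) [Field K] [Algebra K ℂ]
    (M : IntermediateField K ℂ) (T : Set ℂ) (hT : T ⊆ algebraicClosure M ℂ) :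
    trdeg K (adjoin K T) ≤ trdeg K M := by
  haveI := faithfulSMul_of_field K M; haveI := faithfulSMul_of_field M (algebraicClosure M ℂ)
  refine (trdeg_mono (show adjoin K T ≤ (algebraicClosure M ℂ).restrictScalars K from
    adjoin_le_iff.2 hT)).trans_eq ?_
  change trdeg K (algebraicClosure M ℂ) = _
  rw [← trdeg_add_eq K M, trdeg_eq_zero (R := M), add_zero]

/-- Adjoining one more element raises the transcendence degree by at most one. [folklore] -/
theorem trdeg_adjoin_insert_le (K : Type) [Field K] [Algebra K ℂ] (T : Set ℂ) (a : ℂ) :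
    trdeg K (adjoin K (insert a T)) ≤ trdeg K (adjoin K T) + 1 := by
  set M := adjoin K T
  haveI := faithfulSMul_of_field K M; haveI := faithfulSMul_of_field M M⟮a⟯
  have h1 : trdeg M M⟮a⟯ ≤ 1 := by
    refine (trdeg_le_card_of_forall_isAlgebraic M⟮a⟯.toSubalgebra {a}
      fun w hw => ?_).trans_eq (by rw [Finset.card_singleton, Nat.cast_one])
    rw [Finset.coe_singleton, ← isAlgebraic_adjoin_iff]
    exact isAlgebraic_algebraMap (⟨w, hw⟩ : M⟮a⟯)
  calc trdeg K (adjoin K (insert a T)) = trdeg K M⟮a⟯ := by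
        rw [← Set.union_singleton, ← (equivOfEq (adjoin_adjoin_left K T {a})).trdeg_eq]; rfl
    _ = trdeg K M + trdeg M M⟮a⟯ := (trdeg_add_eq K M).symm
    _ ≤ _ := add_le_add le_rfl h1

/-- The (super-additive half of the) tower law along `K ≤ K(S) ≤ K(S ∪ T)`. [folklore] -/
theorem trdeg_add_trdeg_adjoin_le (K : Type) [Field K] [Algebra K ℂ] (S T : Set ℂ) :
    trdeg K (adjoin K S) + trdeg (adjoin K S) (adjoin (adjoin K S) T) ≤
      trdeg K (adjoin K (S ∪ T)) := by
  haveI := faithfulSMul_of_field K (adjoin K S)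
  haveI := faithfulSMul_of_field (adjoin K S) (adjoin (adjoin K S) T)
  refine trdeg_add_le.trans_eq ?_
  rw [← (equivOfEq (adjoin_adjoin_left K S T)).trdeg_eq]; rfl

/-- Base change DOWN only increases the transcendence degree generated by a finite set:
for intermediate fields `F₁ ≤ F₂` of `ℂ / ℚ` and finite `S`, `trdeg_{F₂} F₂(S) ≤ trdeg_{F₁} F₁(S)`
(a transcendence basis of `S` over `F₂` stays algebraically independent over `F₁`). [folklore] -/
theorem trdeg_adjoin_antitone_base (F₁ F₂ : IntermediateField ℚ ℂ) (h12 : F₁ ≤ F₂) (S : Set ℂ)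
    (hS : S.Finite) : trdeg F₂ (adjoin F₂ S) ≤ trdeg F₁ (adjoin F₁ S) := by
  obtain ⟨t, ht⟩ := (AlgebraicIndependent.matroid F₂ ℂ).exists_isBasis S
  obtain ⟨hti, hts, hta⟩ := AlgebraicIndependent.matroid_isBasis_iff.1 ht
  have htf := hS.subset hts
  have hle : adjoin F₂ S ≤ (algebraicClosure (adjoin F₂ t) ℂ).restrictScalars F₂ :=
    adjoin_le_iff.2 fun w hw => mem_algebraicClosure_iff.2 (isAlgebraic_adjoin_iff.2 (hta w hw))
  letI : Algebra F₁ F₂ := (IntermediateField.inclusion h12).toRingHom.toAlgebra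
  haveI : IsScalarTower F₁ F₂ ℂ := .of_algebraMap_eq fun _ => rfl
  calc trdeg F₂ (adjoin F₂ S) ≤ htf.toFinset.card :=
        trdeg_le_card_of_forall_isAlgebraic (adjoin F₂ S).toSubalgebra htf.toFinset
          fun w hw => by
            rw [htf.coe_toFinset, ← isAlgebraic_adjoin_iff]
            exact mem_algebraicClosure_iff.1 (hle hw)
    _ = Cardinal.mk t := by rw [← ncard_eq_toFinset_card t htf, cast_ncard htf]
    _ ≤ _ := (AlgebraicIndependent.of_comp (adjoin F₁ S).val
        (x := fun i : t => (⟨i, subset_adjoin F₁ S (hts i.2)⟩ : adjoin F₁ S))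
        (hti.restrictScalars (IntermediateField.inclusion h12).injective)).cardinalMk_le_trdeg

/-- Elements of `E = span_ℚ(ℚ̄ ∪ {πi})` are `b + q·πi` with `b` algebraic and `q ∈ ℚ`.
[folklore] -/
theorem exists_eq_add_rat_mul_pi_I_of_mem_span (a : ℂ)
    (ha : a ∈ span ℚ ({z : ℂ | IsAlgebraic ℚ z} ∪ {(Real.pi : ℂ) * I})) :
    ∃ b ∈ algebraicClosure ℚ ℂ, ∃ q : ℚ, a = b + q * (Real.pi * I) := by
  rw [span_union, Submodule.mem_sup] at ha
  obtain ⟨b, hb, w, hw, rfl⟩ := ha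
  obtain ⟨q, rfl⟩ := mem_span_singleton.1 hw
  exact ⟨b, (span_le (p := Subalgebra.toSubmodule (algebraicClosure ℚ ℂ).toSubalgebra)).2
    (fun u hu => mem_algebraicClosure_iff.2 hu) hb, q, by rw [Rat.smul_def]⟩

/-- Elements of `E = span_ℚ(ℚ̄ ∪ {πi})` and their exponentials lie in the π–LW field
`L = ℚ(ℚ̄ ∪ {πi} ∪ e^{ℚ̄})` (`e^{b + qπi} = e^b · e^{qπi}`, and `e^{qπi}` is algebraic).
[folklore] -/
theorem mem_piLW_of_mem_span (a : ℂ)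
    (ha : a ∈ span ℚ ({z : ℂ | IsAlgebraic ℚ z} ∪ {(Real.pi : ℂ) * I})) :
    a ∈ adjoin ℚ ({z : ℂ | IsAlgebraic ℚ z} ∪ {(Real.pi : ℂ) * I} ∪
        exp '' {z : ℂ | IsAlgebraic ℚ z}) ∧
      exp a ∈ adjoin ℚ ({z : ℂ | IsAlgebraic ℚ z} ∪ {(Real.pi : ℂ) * I} ∪
        exp '' {z : ℂ | IsAlgebraic ℚ z}) := by
  refine ⟨(span_le (p := Subalgebra.toSubmodule (adjoin ℚ ({z : ℂ | IsAlgebraic ℚ z} ∪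
    {(Real.pi : ℂ) * I} ∪ exp '' {z : ℂ | IsAlgebraic ℚ z})).toSubalgebra)).2
    (fun s hs => subset_adjoin ℚ _ (.inl hs)) ha, ?_⟩
  obtain ⟨b, hb, q, rfl⟩ := exists_eq_add_rat_mul_pi_I_of_mem_span a ha
  rw [exp_add]
  exact mul_mem (subset_adjoin ℚ _ (.inr ⟨b, mem_algebraicClosure_iff.1 hb, rfl⟩))
    (subset_adjoin ℚ _ (.inl (.inl (mem_algebraicClosure_iff.1
      (exp_rat_mul_mem_algebraicClosure ℚ _ q (by rw [exp_pi_mul_I]; exact neg_mem (one_mem _)))))))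

/-- **Inside count.** `PiFreeOverLWField` implies Schanuel's count `k ≤ trdeg ℚ(y, eʸ)` for
`ℚ`-free tuples `y` FROM `E = span_ℚ(ℚ̄ ∪ {πi})`: write `yᵢ = bᵢ + qᵢ πi`; if all `qᵢ = 0` apply
the hypothesis to `y` and drop `π`; otherwise apply it to the `k − 1` algebraic numbers
`q_j y_s − q_s y_j` (`q_j ≠ 0`), over whose exponentials together with `π` the field `ℚ(y, eʸ)`
is co-algebraic. [folklore] -/
theorem inside_count (hP : GaussianStokesSector.PiFreeOverLWField) (k : ℕ) (y : Fin k → ℂ)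
    (hy : ∀ i, y i ∈ span ℚ ({z : ℂ | IsAlgebraic ℚ z} ∪ {(Real.pi : ℂ) * I}))
    (hli : LinearIndependent ℚ y) :
    (k : Cardinal) ≤ trdeg ℚ (adjoin ℚ (range y ∪ range (exp ∘ y))) := by
  have hAC : ∀ {R : Type} [Field R] [Algebra R ℂ] {w : ℂ},
      w ∈ algebraicClosure R ℂ ↔ IsAlgebraic R w := mem_algebraicClosure_iff
  choose b hb q hyq using fun i => exists_eq_add_rat_mul_pi_I_of_mem_span _ (hy i)
  set F := adjoin ℚ (range y ∪ range (exp ∘ y))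
  by_cases hq : ∀ i, q i = 0
  · have h1 := hP k y (fun i => hAC.1 (by
      rw [hyq i, hq i, Rat.cast_zero, zero_mul, add_zero]; exact hb i)) hli
    rw [Nat.cast_succ] at h1
    exact Cardinal.add_one_le_add_one_iff.1 (h1.trans ((trdeg_adjoin_insert_le ℚ _ _).trans
      (add_le_add (trdeg_mono (adjoin.mono ℚ _ _ subset_union_right)) le_rfl)))
  obtain ⟨j, hj⟩ := not_forall.1 hq
  obtain ⟨k, rfl⟩ : ∃ k', k = k' + 1 := ⟨k - 1, by have := j.pos; omega⟩
  have aF : ∀ {w : ℂ}, w ∈ F → IsAlgebraic F w := fun hw => isAlgebraic_algebraMap (⟨_, hw⟩ : F)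
  have yF : ∀ i, y i ∈ F := fun i => subset_adjoin ℚ _ (.inl ⟨i, rfl⟩)
  have eF : ∀ i, exp (y i) ∈ algebraicClosure F ℂ := fun i =>
    hAC.2 (aF (subset_adjoin ℚ _ (.inr ⟨i, rfl⟩)))
  set a : Fin k → ℂ := fun s => q j • y (j.succAbove s) - q (j.succAbove s) • y j with ha
  have hal : ∀ s, IsAlgebraic ℚ (a s) := fun s => hAC.1 (by
    have : a s = (q j : ℂ) * b (j.succAbove s) - (q (j.succAbove s) : ℂ) * b j := by
      simp only [ha, Rat.smul_def]
      rw [hyq (j.succAbove s), hyq j, mul_add, mul_add, mul_left_comm ((q j : ℚ) : ℂ),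
        add_sub_add_right_eq_sub]
    rw [this]
    exact sub_mem (mul_mem (SubfieldClass.ratCast_mem _ _) (hb _))
      (mul_mem (SubfieldClass.ratCast_mem _ _) (hb _)))
  have hli' : LinearIndependent ℚ a := by
    rw [Fintype.linearIndependent_iff]
    intro g hg s
    have h0 := Fintype.linearIndependent_iff.mp hli
      (Fin.insertNth j (-∑ s, g s * q (j.succAbove s)) fun s => g s * q j) (by
        rw [Fin.sum_univ_succAbove _ j, Fin.insertNth_apply_same, ← hg]
        simp only [Fin.insertNth_apply_succAbove, ha, smul_sub, mul_smul, neg_smul,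
          Finset.sum_smul, Finset.sum_sub_distrib]
        abel) (j.succAbove s)
    rw [Fin.insertNth_apply_succAbove] at h0
    exact (mul_eq_zero.mp h0).resolve_right hj
  have hpi : IsAlgebraic F (Real.pi : ℂ) := by
    have hqj : ((q j : ℚ) : ℂ) ≠ 0 := by exact_mod_cast hj
    have h1 : (Real.pi : ℂ) * I = (y j - b j) * (((q j)⁻¹ : ℚ) : ℂ) := by
      rw [Rat.cast_inv, hyq j, add_sub_cancel_left, mul_comm ((q j : ℚ) : ℂ),
        mul_inv_cancel_right₀ hqj]
    have h2 : (Real.pi : ℂ) = -(Real.pi * I * I) := by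
      rw [mul_assoc, I_mul_I, mul_neg_one, neg_neg]
    rw [h2, h1]
    exact ((((aF (yF j)).sub ((hAC.1 (hb j)).tower_top (L := F))).mul
      (aF (SubfieldClass.ratCast_mem F _))).mul
      (.of_pow two_pos (by rw [I_sq]; exact isAlgebraic_one.neg))).neg
  refine (hP k a hal hli').trans (trdeg_adjoin_le_of_subset_algebraicClosure ℚ F _ ?_)
  rintro w (rfl | ⟨s, rfl⟩)
  · exact hAC.2 hpi
  · simp only [Function.comp_apply, ha, Rat.smul_def, exp_sub]
    exact div_mem (exp_rat_mul_mem_algebraicClosure F _ _ (eF _))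
      (exp_rat_mul_mem_algebraicClosure F _ _ (eF _))

/-- **The sector engine** (Kirby's `GL_n(ℚ)` split along `E = span_ℚ(ℚ̄ ∪ {πi})` over
`L = ℚ(ℚ̄ ∪ {πi} ∪ e^{ℚ̄})`, run inside a constraint `ℚ`-submodule `C`): the inside count
`PiFreeOverLWField` and the outside count (relative Schanuel over `L` for tuples FROM `C` free
modulo `E`) give Schanuel's count `n ≤ trdeg ℚ(x, eˣ)` for every `ℚ`-free tuple `x` from `C` —
adapted basis `y ⊂ V ⊓ E`, `z ⊂ U` of `V = span_ℚ(x)`, inside count at `y`, outside count at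
`z ⊂ C`, base change `L ↝ ℚ(y, eʸ)`, tower law, and `ℚ(y, eʸ, z, eᶻ) ⊆ ℚ(x, eˣ)^{alg}`.
[folklore] -/
theorem engine (C : Submodule ℚ ℂ) (hP : GaussianStokesSector.PiFreeOverLWField)
    (hR : ∀ (n : ℕ) (x : Fin n → ℂ), (∀ i, x i ∈ C) →
      LinearIndependent ℚ ((Submodule.span ℚ
        ({z : ℂ | IsAlgebraic ℚ z} ∪ {(Real.pi : ℂ) * Complex.I})).mkQ ∘ x) →
      (n : Cardinal) ≤ Algebra.trdeg
        ↥(IntermediateField.adjoin ℚ ({z : ℂ | IsAlgebraic ℚ z} ∪ {(Real.pi : ℂ) * Complex.I} ∪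
          Complex.exp '' {z : ℂ | IsAlgebraic ℚ z}))
        ↥(IntermediateField.adjoin ↥(IntermediateField.adjoin ℚ ({z : ℂ | IsAlgebraic ℚ z} ∪
          {(Real.pi : ℂ) * Complex.I} ∪ Complex.exp '' {z : ℂ | IsAlgebraic ℚ z}))
          (Set.range x ∪ Set.range (Complex.exp ∘ x)))) :
    ∀ (n : ℕ) (x : Fin n → ℂ), (∀ i, x i ∈ C) → LinearIndependent ℚ x →
      (n : Cardinal) ≤ Algebra.trdeg ℚ
        ↥(IntermediateField.adjoin ℚ (Set.range x ∪ Set.range (Complex.exp ∘ x))) := by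
  intro n x hxC hx
  have hAC : ∀ {R : Type} [Field R] [Algebra R ℂ] {w : ℂ},
      w ∈ algebraicClosure R ℂ ↔ IsAlgebraic R w := mem_algebraicClosure_iff
  set E : Submodule ℚ ℂ := span ℚ ({z : ℂ | IsAlgebraic ℚ z} ∪ {(Real.pi : ℂ) * I}) with hE
  set L := adjoin ℚ ({z : ℂ | IsAlgebraic ℚ z} ∪ {(Real.pi : ℂ) * I} ∪
    exp '' {z : ℂ | IsAlgebraic ℚ z})
  set V : Submodule ℚ ℂ := span ℚ (range x) with hV
  have hVC : V ≤ C := span_le.2 (range_subset_iff.2 hxC)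
  haveI : FiniteDimensional ℚ V := FiniteDimensional.span_of_finite ℚ (finite_range x)
  obtain ⟨U', hU'⟩ := (V ⊓ E).exists_isCompl
  set W : Submodule ℚ ℂ := V ⊓ E
  set U : Submodule ℚ ℂ := V ⊓ U' with hU
  haveI : FiniteDimensional ℚ W := finiteDimensional_of_le inf_le_left
  haveI : FiniteDimensional ℚ U := finiteDimensional_of_le inf_le_left
  have hsup : W ⊔ U = V := by
    rw [hU, inf_comm, ← sup_inf_assoc_of_le U' (inf_le_left : W ≤ V), hU'.sup_eq_top, top_inf_eq]
  have hdj : Disjoint W U := hU'.disjoint.mono_right inf_le_right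
  set k := Module.finrank ℚ W
  set m := Module.finrank ℚ U
  have hn : k + m = n := by
    have h1 := finrank_sup_add_finrank_inf_eq W U
    rw [hdj.eq_bot, finrank_bot, add_zero, hsup, hV, finrank_span_eq_card hx,
      Fintype.card_fin] at h1
    exact h1.symm
  let bW := Module.finBasis ℚ W
  let bU := Module.finBasis ℚ U
  let y : Fin k → ℂ := fun i => bW i
  let z : Fin m → ℂ := fun j => bU j
  have hyli : LinearIndependent ℚ y := bW.linearIndependent.map' W.subtype W.ker_subtype
  have hzli : LinearIndependent ℚ z := bU.linearIndependent.map' U.subtype U.ker_subtype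
  have hyE : ∀ i, y i ∈ E := fun i => (bW i).2.2
  have hzC : ∀ j, z j ∈ C := fun j => hVC (bU j).2.1
  have hzE : LinearIndependent ℚ (E.mkQ ∘ z) := by
    refine hzli.map ?_
    rw [ker_mkQ, disjoint_def]
    intro u hu huE
    have huU : u ∈ U := span_le.2 (range_subset_iff.2 fun j => (bU j).2) hu
    exact disjoint_def.1 hdj u ⟨huU.1, huE⟩ huU
  set Sy := range y ∪ range (exp ∘ y)
  set Sz := range z ∪ range (exp ∘ z)
  set Ky := adjoin ℚ Sy
  set Kx := adjoin ℚ (range x ∪ range (exp ∘ x))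
  have hKyL : Ky ≤ L := adjoin_le_iff.2 (by
    rintro _ (⟨i, rfl⟩ | ⟨i, rfl⟩)
    exacts [(mem_piLW_of_mem_span _ (hyE i)).1, (mem_piLW_of_mem_span _ (hyE i)).2])
  have hVK : ∀ a ∈ V, a ∈ Kx ∧ exp a ∈ algebraicClosure Kx ℂ := by
    intro a ha
    obtain ⟨c, rfl⟩ := (mem_span_range_iff_exists_fun ℚ).1 ha
    refine ⟨sum_mem fun i _ => Kx.toSubalgebra.smul_mem (subset_adjoin ℚ _ (.inl ⟨i, rfl⟩)) _, ?_⟩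
    simp_rw [Rat.smul_def]
    rw [exp_sum]
    exact prod_mem fun i _ => exp_rat_mul_mem_algebraicClosure Kx _ _
      (hAC.2 (isAlgebraic_algebraMap (⟨_, subset_adjoin ℚ _ (.inr ⟨i, rfl⟩)⟩ : Kx)))
  refine (show (n : Cardinal) = k + m by rw [← hn, Nat.cast_add]).trans_le ((add_le_add
    (inside_count hP k y hyE hyli) ((hR m z hzC hzE).trans
    (trdeg_adjoin_antitone_base Ky L hKyL Sz ((finite_range z).union (finite_range _))))).trans
    ((trdeg_add_trdeg_adjoin_le ℚ Sy Sz).trans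
    (trdeg_adjoin_le_of_subset_algebraicClosure ℚ Kx _ ?_)))
  rintro w ((⟨i, rfl⟩ | ⟨i, rfl⟩) | (⟨j, rfl⟩ | ⟨j, rfl⟩))
  · exact hAC.2 (isAlgebraic_algebraMap (⟨_, (hVK _ (bW i).2.1).1⟩ : Kx))
  · exact (hVK _ (bW i).2.1).2
  · exact hAC.2 (isAlgebraic_algebraMap (⟨_, (hVK _ (bU j).2.1).1⟩ : Kx))
  · exact (hVK _ (bU j).2.1).2

/-- The sector engine for tuples from an intermediate field `K₀` (e.g. the log-free core
`C_EA`): `SectorGlue.engine` at the `ℚ`-submodule underlying `K₀`. [folklore] -/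
theorem engine_field (K₀ : IntermediateField ℚ ℂ) (hP : GaussianStokesSector.PiFreeOverLWField)
    (hR : ∀ (n : ℕ) (x : Fin n → ℂ), (∀ i, x i ∈ K₀) →
      LinearIndependent ℚ ((Submodule.span ℚ
        ({z : ℂ | IsAlgebraic ℚ z} ∪ {(Real.pi : ℂ) * Complex.I})).mkQ ∘ x) →
      (n : Cardinal) ≤ Algebra.trdeg
        ↥(IntermediateField.adjoin ℚ ({z : ℂ | IsAlgebraic ℚ z} ∪ {(Real.pi : ℂ) * Complex.I} ∪
          Complex.exp '' {z : ℂ | IsAlgebraic ℚ z}))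
        ↥(IntermediateField.adjoin ↥(IntermediateField.adjoin ℚ ({z : ℂ | IsAlgebraic ℚ z} ∪
          {(Real.pi : ℂ) * Complex.I} ∪ Complex.exp '' {z : ℂ | IsAlgebraic ℚ z}))
          (Set.range x ∪ Set.range (Complex.exp ∘ x)))) :
    ∀ (n : ℕ) (x : Fin n → ℂ), (∀ i, x i ∈ K₀) → LinearIndependent ℚ x →
      (n : Cardinal) ≤ Algebra.trdeg ℚ
        ↥(IntermediateField.adjoin ℚ (Set.range x ∪ Set.range (Complex.exp ∘ x))) :=
  fun n x hx hli => engine (Subalgebra.toSubmodule K₀.toSubalgebra) hP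
    (fun n x hx h => hR n x hx h) n x hx hli

end SectorGlue

/-- **Registered stub `stub_sectorGlue` of line `sector-split`** (signature verbatim): the
`GL_n(ℚ)` sector reduction along `V₂ = span_ℚ(ℚ̄ ∪ {πi})`, run on tuples from the log-free core
`C_EA`: `PiFreeOverLWField` (residue 1) and relative Schanuel over the π–LW field for CORE tuples
free modulo `V₂` (residue 2) imply (R) — `SectorGlue.engine_field` at the core `C_EA`.
[folklore] -/
theorem stub_sectorGlue :
    GaussianStokesSector.PiFreeOverLWField →
    (∀ (n : ℕ) (x : Fin n → ℂ),
      (∀ i, x i ∈ (sInf {K : IntermediateField ℚ ℂ | (2 * ↑Real.pi * Complex.I : ℂ) ∈ K ∧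
        (∀ w ∈ K, Complex.exp w ∈ K) ∧ ∀ w : ℂ, IsAlgebraic K w → w ∈ K} : IntermediateField ℚ ℂ)) →
      LinearIndependent ℚ ((Submodule.span ℚ ({z : ℂ | IsAlgebraic ℚ z} ∪ {(Real.pi : ℂ) * Complex.I})).mkQ ∘ x) →
      (n : Cardinal) ≤ Algebra.trdeg
        ↥(IntermediateField.adjoin ℚ ({z : ℂ | IsAlgebraic ℚ z} ∪ {(Real.pi : ℂ) * Complex.I} ∪ Complex.exp '' {z : ℂ | IsAlgebraic ℚ z}))
        ↥(IntermediateField.adjoin ↥(IntermediateField.adjoin ℚ ({z : ℂ | IsAlgebraic ℚ z} ∪ {(Real.pi : ℂ) * Complex.I} ∪ Complex.exp '' {z : ℂ | IsAlgebraic ℚ z})) (Set.range x ∪ Set.range (Complex.exp ∘ x)))) →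
    ∀ (n : ℕ) (x : Fin n → ℂ),
      (∀ i, x i ∈ (sInf {K : IntermediateField ℚ ℂ | (2 * ↑Real.pi * Complex.I : ℂ) ∈ K ∧
        (∀ w ∈ K, Complex.exp w ∈ K) ∧ ∀ w : ℂ, IsAlgebraic K w → w ∈ K} : IntermediateField ℚ ℂ)) →
      LinearIndependent ℚ x →
      (n : Cardinal) ≤ Algebra.trdeg ℚ ↥(IntermediateField.adjoin ℚ (Set.range x ∪ Set.range (Complex.exp ∘ x))) :=
  fun hP hR => SectorGlue.engine_field _ hP hR

/-- **Registered stub `stub_sectorAssembly` of line `sector-split`** (signature verbatim): the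
unrestricted sector reduction `PiFreeOverLWField → RelSchanuelOverPiLWField → Schanuel`, i.e. the
statement of the assembly item stmt-Schanuel-9557 of routes ExceptionalSubspaces /
GaussianStokesSector / SingularModulusScaling — `SectorGlue.engine` at `C = ⊤`. [folklore] -/
theorem stub_sectorAssembly :
    GaussianStokesSector.PiFreeOverLWField → GaussianStokesSector.RelSchanuelOverPiLWField →
      Schanuel := by
  intro hP hR n x hx
  exact SectorGlue.engine ⊤ hP (fun n x _ h => hR n x h) n x (fun _ => Submodule.mem_top) hx

/-- The sector split concludes the crux BY NAME: `PiFreeOverLWField` and core-restricted relative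
Schanuel over the π–LW field imply `RigidCore.SchanuelOnLogFreeCore` (item stmt-Schanuel-0970).
[folklore] -/
theorem SectorGlue.schanuelOnLogFreeCore_of_piFree_of_coreRel
    (hP : GaussianStokesSector.PiFreeOverLWField)
    (hR : ∀ (n : ℕ) (x : Fin n → ℂ),
      (∀ i, x i ∈ (sInf {K : IntermediateField ℚ ℂ | (2 * ↑Real.pi * Complex.I : ℂ) ∈ K ∧
        (∀ w ∈ K, Complex.exp w ∈ K) ∧ ∀ w : ℂ, IsAlgebraic K w → w ∈ K} : IntermediateField ℚ ℂ)) →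
      LinearIndependent ℚ ((Submodule.span ℚ ({z : ℂ | IsAlgebraic ℚ z} ∪ {(Real.pi : ℂ) * Complex.I})).mkQ ∘ x) →
      (n : Cardinal) ≤ Algebra.trdeg
        ↥(IntermediateField.adjoin ℚ ({z : ℂ | IsAlgebraic ℚ z} ∪ {(Real.pi : ℂ) * Complex.I} ∪ Complex.exp '' {z : ℂ | IsAlgebraic ℚ z}))
        ↥(IntermediateField.adjoin ↥(IntermediateField.adjoin ℚ ({z : ℂ | IsAlgebraic ℚ z} ∪ {(Real.pi : ℂ) * Complex.I} ∪ Complex.exp '' {z : ℂ | IsAlgebraic ℚ z})) (Set.range x ∪ Set.range (Complex.exp ∘ x)))) :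
    RigidCore.SchanuelOnLogFreeCore :=
  stub_sectorGlue hP hR

/-- The assembly item stmt-Schanuel-9557 of route GaussianStokesSector
(`PiFreeOverLWField → RelSchanuelOverPiLWField → Schanuel`) holds. [folklore] -/
theorem SectorGlue.gaussianStokesSector_assembly : GaussianStokesSector.Assembly :=
  stub_sectorAssembly

end Summit.Schanuel.Schanuel.Theorems.RigidCore
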